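import Summits.NavierStokesRegularity.NavierStokesRegularity.Theorems.TerminalTraceTypeITraceScarL3DepthEnstrophyFloor
import Literature.Analysis.FluidPDE.LocalTypeIScaling
import HarnessLib

/-!
# Depth vorticity rigidity, part 5 — (Q1) of ROUND-26 at EVERY scale: the vorticity floor
# `∫∫_{]−T,−T/2[ × B(0,√T)} |curl U| ≥ κ₀ T^{3/2}` for singular extinct Type-I apices — helper for item
# `TerminalTrace.TypeITraceScarL3` (stmt-NavierStokesRegularity-18385), stub QA of line `annulus-dichotomy`

Seat nsreg-C26-p1 (prover), `--supports stmt-NavierStokesRegularity-18385`; planner of record nsreg-p2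
g28, ROUND-26 §1c (Q1).  The apex class `(M, C)` — suitable in every `Q(a)`, weak gradient, `𝐈 ≤ M`,
rate `C/√(−s)` — and backward singularity at the origin are invariant under the parabolic zoom
`U ↦ μ U(μ²·, μ·)` (`IsSuitableWeakSolutionInBall.zoomOut`, `HasWeakSpatialGradientOn.stRescale`,
`typeIBound_nsZoom`, `eLpNorm_top_nsZoom`), so the unit-scale floor `exists_depth_vorticity_floor`
gives, by the change of variables `setLIntegral_preimage_comp_stAffine`:

* `exists_depth_vorticity_floor_scaled` — `∃ κ₀ = κ₀(M, C) > 0`, for every such `(U, P, G)` singular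
  at the origin and every `T > 0`: `∫∫_{]−T,−T/2[ × B(0,√T)} |curlCLM (G)| ≥ κ₀ (√T)³`.

WHAT THIS IS NOT: not Stub QA, not item 18385, no statement about Navier–Stokes regularity.
[folklore; AlbrittonBarker2019 §3 (scale invariance of the class); Tao2021 §5 (5.3)–(5.6)]
-/

noncomputable section

set_option linter.dupNamespace false

namespace Summit.NavierStokesRegularity.NavierStokesRegularity.Theorems.TypeITraceScarL3

open MeasureTheory Set Function Filter Topology TopologicalSpace Metric InnerProductSpace
open Literature.Analysis Literature.Analysis.FluidPDE
open scoped NNReal ENNReal RealInnerProductSpace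

/-- **(Q1) at every scale.**  For every class `(M, C)` there is `κ₀ > 0` such that: if `(U, P)` is a
suitable weak solution in every `Q(a)` about the origin with weak gradient `G`, `𝐈(Q(a)) ≤ M`, rate
`‖U(s, ·)‖ ≤ C/√(−s)` a.e. for `s < 0`, and the origin is backward-singular, then for every `T > 0`
the distributional vorticity satisfies `∫∫_{]−T,−T/2[ × B(0,√T)} |curlCLM (G)| ≥ κ₀ (√T)³`
(parabolic rescaling of `exists_depth_vorticity_floor`). [folklore; AlbrittonBarker2019 §3] -/
theorem exists_depth_vorticity_floor_scaled (M : ℝ≥0) (C : ℝ) :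
    ∃ κ₀ : ℝ, 0 < κ₀ ∧
    ∀ (U : ℝ → EuclideanSpace ℝ (Fin 3) → EuclideanSpace ℝ (Fin 3))
      (P : ℝ → EuclideanSpace ℝ (Fin 3) → ℝ)
      (G : ℝ → EuclideanSpace ℝ (Fin 3) → EuclideanSpace ℝ (Fin 3) →L[ℝ] EuclideanSpace ℝ (Fin 3)),
      (∀ a : ℝ, 0 < a →
        IsSuitableWeakSolutionInBall a (0 : ℝ × EuclideanSpace ℝ (Fin 3)) U P) →
      (∀ a : ℝ, 0 < a →
        HasWeakSpatialGradientOn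
          (parabolicCylinderOpens a (0 : ℝ × EuclideanSpace ℝ (Fin 3))) U G) →
      (∀ a : ℝ, 0 < a →
        typeIBound (parabolicCylinder a (0 : ℝ × EuclideanSpace ℝ (Fin 3))) U P G ≤ M) →
      (∀ s : ℝ, s < 0 →
        ∀ᵐ y : EuclideanSpace ℝ (Fin 3), ‖U s y‖ ≤ C / Real.sqrt (-s)) →
      IsBackwardSingularPoint U (0 : ℝ × EuclideanSpace ℝ (Fin 3)) →
      ∀ T : ℝ, 0 < T →
        ENNReal.ofReal (κ₀ * Real.sqrt T ^ 3) ≤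
          ∫⁻ z in Ioo (-T) (-T / 2) ×ˢ ball (0 : EuclideanSpace ℝ (Fin 3)) (Real.sqrt T),
            ‖curlCLM (G z.1 z.2)‖ₑ := by
  obtain ⟨κ₀, hκ₀, hfloor⟩ := exists_depth_vorticity_floor M C
  refine ⟨κ₀, hκ₀, fun U P G hsw hG hI hrate hsing T hT => ?_⟩
  -- ### the scale `μ = √T`
  set μ : ℝ := Real.sqrt T with hμdef
  have hμpos : 0 < μ := Real.sqrt_pos.2 hT
  have hμ0 : μ ≠ 0 := hμpos.ne'
  have hμ2 : 0 < μ ^ 2 := pow_pos hμpos 2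
  have hμsq : μ ^ 2 = T := Real.sq_sqrt hT.le
  -- ### the rescaled triple
  set U' : ℝ → EuclideanSpace ℝ (Fin 3) → EuclideanSpace ℝ (Fin 3) :=
    μ • stPull (μ ^ 2) μ (0 : ℝ) (0 : EuclideanSpace ℝ (Fin 3)) U with hU'def
  set P' : ℝ → EuclideanSpace ℝ (Fin 3) → ℝ :=
    μ ^ 2 • stPull (μ ^ 2) μ (0 : ℝ) (0 : EuclideanSpace ℝ (Fin 3)) P with hP'def
  set G' : ℝ → EuclideanSpace ℝ (Fin 3) → EuclideanSpace ℝ (Fin 3) →L[ℝ] EuclideanSpace ℝ (Fin 3) :=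
    μ ^ 2 • stPull (μ ^ 2) μ (0 : ℝ) (0 : EuclideanSpace ℝ (Fin 3)) G with hG'def
  have hU'apply : ∀ s y, U' s y = μ • U (μ ^ 2 * s) (μ • y) := fun s y => by
    rw [hU'def]; simp only [Pi.smul_apply, stPull_apply, zero_add]
  have hG'apply : ∀ s y, G' s y = μ ^ 2 • G (μ ^ 2 * s) (μ • y) := fun s y => by
    rw [hG'def]; simp only [Pi.smul_apply, stPull_apply, zero_add]
  have hst0 : ∀ z : ℝ × EuclideanSpace ℝ (Fin 3),
      stAffine (μ ^ 2) μ (0 : ℝ) (0 : EuclideanSpace ℝ (Fin 3)) z = (μ ^ 2 * z.1, μ • z.2) := by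
    intro z
    rw [show z = (z.1, z.2) from rfl, stAffine_apply, zero_add, zero_add]
  -- (i) suitable in every `Q(a)`
  have hsw' : ∀ a : ℝ, 0 < a →
      IsSuitableWeakSolutionInBall a (0 : ℝ × EuclideanSpace ℝ (Fin 3)) U' P' := by
    intro a ha
    have h := (hsw (a * μ) (mul_pos ha hμpos)).zoomOut hμpos
    rwa [mul_div_cancel_right₀ a hμ0] at h
  -- (ii) the weak gradient
  have hG' : ∀ a : ℝ, 0 < a →
      HasWeakSpatialGradientOn (parabolicCylinderOpens a (0 : ℝ × EuclideanSpace ℝ (Fin 3))) U' G' := by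
    intro a ha
    have h := (hG (a * μ) (mul_pos ha hμpos)).stRescale μ hμ2 hμpos (0 : ℝ)
      (0 : EuclideanSpace ℝ (Fin 3))
    have hpre : stPreimage (μ ^ 2) μ (0 : ℝ) (0 : EuclideanSpace ℝ (Fin 3))
        (parabolicCylinderOpens (a * μ) (0 : ℝ × EuclideanSpace ℝ (Fin 3))) =
        parabolicCylinderOpens a (0 : ℝ × EuclideanSpace ℝ (Fin 3)) := by
      apply TopologicalSpace.Opens.ext
      rw [coe_stPreimage, coe_parabolicCylinderOpens, coe_parabolicCylinderOpens,
        stAffine_preimage_parabolicCylinder_zero hμpos, mul_div_cancel_right₀ a hμ0]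
    rw [hpre, show μ * μ = μ ^ 2 by ring] at h
    exact h
  -- (iii) `𝐈 ≤ M`
  have hI' : ∀ a : ℝ, 0 < a →
      typeIBound (parabolicCylinder a (0 : ℝ × EuclideanSpace ℝ (Fin 3))) U' P' G' ≤ M := by
    intro a ha
    rw [← mul_div_cancel_right₀ a hμ0, ← stAffine_preimage_parabolicCylinder_zero hμpos (a * μ),
      hU'def, hP'def, hG'def, typeIBound_nsZoom hμpos]
    exact hI (a * μ) (mul_pos ha hμpos)
  -- (iv) the rate
  have hrate' : ∀ s : ℝ, s < 0 → ∀ᵐ y : EuclideanSpace ℝ (Fin 3), ‖U' s y‖ ≤ C / Real.sqrt (-s) := by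
    -- adapted from `stub_no_confinedExtinctApex` (step (v))
    intro s hs
    have hs2 : μ ^ 2 * s < 0 := mul_neg_of_pos_of_neg hμ2 hs
    have h := (Measure.quasiMeasurePreserving_smul volume hμ0).ae (hrate (μ ^ 2 * s) hs2)
    filter_upwards [h] with y hy
    have hsq : Real.sqrt (-(μ ^ 2 * s)) = μ * Real.sqrt (-s) := by
      rw [show -(μ ^ 2 * s) = μ ^ 2 * (-s) by ring, Real.sqrt_mul hμ2.le, Real.sqrt_sq hμpos.le]
    rw [hU'apply, norm_smul, Real.norm_eq_abs, abs_of_pos hμpos]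
    have hy' : ‖U (μ ^ 2 * s) (μ • y)‖ ≤ C / (μ * Real.sqrt (-s)) := by rw [← hsq]; exact hy
    calc μ * ‖U (μ ^ 2 * s) (μ • y)‖ ≤ μ * (C / (μ * Real.sqrt (-s))) :=
          mul_le_mul_of_nonneg_left hy' hμpos.le
      _ = C / Real.sqrt (-s) := by field_simp
  -- (v) the origin stays backward-singular
  have hsing' : IsBackwardSingularPoint U' (0 : ℝ × EuclideanSpace ℝ (Fin 3)) := by
    intro r hr
    rw [hU'def, eLpNorm_top_nsZoom hμpos, hst0]
    simp only [Prod.fst_zero, Prod.snd_zero, mul_zero, smul_zero]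
    rw [show ((0 : ℝ), (0 : EuclideanSpace ℝ (Fin 3))) = (0 : ℝ × EuclideanSpace ℝ (Fin 3)) from rfl,
      hsing (μ * r) (mul_pos hμpos hr)]
    exact ENNReal.mul_top (by simpa using hμpos)
  -- ### the unit-scale floor for the rescaled triple
  have hunit := hfloor U' P' G' hsw' hG' hI' hrate' hsing'
  -- ### change of variables
  set S : Set (ℝ × EuclideanSpace ℝ (Fin 3)) :=
    Ioo (-T) (-T / 2) ×ˢ ball (0 : EuclideanSpace ℝ (Fin 3)) (Real.sqrt T) with hSdef
  set F : ℝ × EuclideanSpace ℝ (Fin 3) → ℝ≥0∞ := fun w => ‖curlCLM (G w.1 w.2)‖ₑ with hFdef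
  have hpre : Ioo (-1 : ℝ) (-1 / 2) ×ˢ ball (0 : EuclideanSpace ℝ (Fin 3)) 1 =
      stAffine (μ ^ 2) μ (0 : ℝ) (0 : EuclideanSpace ℝ (Fin 3)) ⁻¹' S := by
    ext ⟨s, y⟩
    rw [mem_preimage, hst0]
    simp only [mem_prod, mem_Ioo, mem_ball_zero_iff, norm_smul, Real.norm_eq_abs, abs_of_pos hμpos,
      hSdef, ← hμdef]
    rw [← hμsq]
    constructor
    · rintro ⟨⟨h1, h2⟩, h3⟩
      refine ⟨⟨by nlinarith, by nlinarith⟩, by nlinarith⟩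
    · rintro ⟨⟨h1, h2⟩, h3⟩
      refine ⟨⟨by nlinarith, by nlinarith⟩, by nlinarith⟩
  have hint : ∫⁻ z in Ioo (-1 : ℝ) (-1 / 2) ×ˢ ball (0 : EuclideanSpace ℝ (Fin 3)) 1,
      ‖curlCLM (G' z.1 z.2)‖ₑ = ENNReal.ofReal (μ ^ 3)⁻¹ * ∫⁻ z in S, F z := by
    have e1 : ∀ z : ℝ × EuclideanSpace ℝ (Fin 3), ‖curlCLM (G' z.1 z.2)‖ₑ =
        ENNReal.ofReal (μ ^ 2) * F (stAffine (μ ^ 2) μ (0 : ℝ) (0 : EuclideanSpace ℝ (Fin 3)) z) := by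
      intro z
      rw [hG'apply, map_smul, enorm_smul, hFdef, hst0]
      simp only
      rw [Real.enorm_eq_ofReal (le_of_lt hμ2)]
    simp_rw [e1]
    rw [hpre, lintegral_const_mul' _ _ ENNReal.ofReal_ne_top,
      setLIntegral_preimage_comp_stAffine hμ2 hμpos, finrank_euclideanSpace_fin, ← mul_assoc,
      ← ENNReal.ofReal_mul (le_of_lt hμ2)]
    congr 2
    field_simp
  rw [hint] at hunit
  -- ### conclusion: multiply by `μ³`
  have hμ3 : 0 < μ ^ 3 := pow_pos hμpos 3
  calc ENNReal.ofReal (κ₀ * Real.sqrt T ^ 3)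
      = ENNReal.ofReal (μ ^ 3) * ENNReal.ofReal κ₀ := by
        rw [← ENNReal.ofReal_mul (le_of_lt hμ3), ← hμdef, mul_comm]
    _ ≤ ENNReal.ofReal (μ ^ 3) * (ENNReal.ofReal (μ ^ 3)⁻¹ * ∫⁻ z in S, F z) := by
        gcongr
    _ = ∫⁻ z in S, F z := by
        rw [← mul_assoc, ← ENNReal.ofReal_mul (le_of_lt hμ3), mul_inv_cancel₀ hμ3.ne',
          ENNReal.ofReal_one, one_mul]

end Summit.NavierStokesRegularity.NavierStokesRegularity.Theorems.TypeITraceScarL3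

end
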